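import Mathlib
import HarnessLib

/-!
# ValiantsHypothesis / LacunarySymmetroid — crux `MatrixDescartes` (stmt-ValiantsHypothesis-18050, V1),
# line `Cruxes/MatrixDescartes/Lines/osculation_law.lean` («osculation-law»), stub `stub_peel` (all ranks `r`):
# CALCULUS ON AN IMPLICIT BRANCH of the spectral curve `Φ(t, b) = 0`

Helper file 1/2 of the BRANCH-ARC ENGINE `OsculationPeel.card_roots_filter_branchArc_le_two` («a monomial arc
`b = c·t^N` meets an osculation-free smooth branch arc of `{Φ = 0}` at most twice, counted with multiplicity»),
which is the per-arc half of `stub_peel` for EVERY rank `r` (the rank-one engine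
`…OsculationLawPeelRankOneArc` works with the explicit rational branch `b = −f/a` and does not transfer).

Contents (all `theorem`s, Mathlib only, no definitions, no named facts), for `Φ : MvPolynomial (Fin 2) ℝ` and a
branch `β` that is twice differentiable on an open interval with `Φ(t, β t) = 0`:
* `hasDerivAt_mvPolynomial_eval` — the chain rule for `t ↦ Φ(x t, y t)`;
* `pderiv_pderiv_comm` — mixed partials commute;
* `branch_first_order`, `branch_second_order` — `Φ₀ + Φ₁ β' = 0` and its derivative along the branch;
* `logHessian_eval_eq` — **the key identity `H(Φ)(t, b) = −t·b·Φ₁³·(b β' + t b β'' − t β'²)`**, i.e.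
  `t·b³·Φ₁³·(tβ'/β)' = −H(Φ)` (`H` = the line's bordered log-Hessian `logHessian`, UNFOLDED token for token,
  `Φ_i = pderiv i Φ`): on a branch with `Φ₁ ≠ 0`, `b > 0`, `t > 0` the log-log curvature `(tβ'/β)'` vanishes
  exactly at the osculation points.

Honest framing: infrastructure for an OPEN stub; `stub_peel`, the LAW, `MatrixDescartes`, Conjecture B and
`VP ≠ VNP` are NOT proved and nothing here is progress on them.
-/

-- `Summit.ValiantsHypothesis.ValiantsHypothesis.…` is the tree's mandated single-conjunct layout (Sub = Summit).
set_option linter.dupNamespace false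

noncomputable section

namespace Summit.ValiantsHypothesis.ValiantsHypothesis.Theorems.LacunarySymmetroidMatrixDescartes

open Polynomial Set MvPolynomial
open scoped BigOperators

namespace OsculationPeel

/-! ### The chain rule for `MvPolynomial (Fin 2) ℝ` along a curve -/

/-- **Chain rule**: `d/dt Φ(x t, y t) = Φ₀(x,y)·x' + Φ₁(x,y)·y'` (`Φ_i = pderiv i Φ`). [folklore] -/
theorem hasDerivAt_mvPolynomial_eval (Φ : MvPolynomial (Fin 2) ℝ) {x y : ℝ → ℝ} {x' y' t : ℝ}
    (hx : HasDerivAt x x' t) (hy : HasDerivAt y y' t) :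
    HasDerivAt (fun s => MvPolynomial.eval ![x s, y s] Φ)
      (MvPolynomial.eval ![x t, y t] (pderiv 0 Φ) * x' + MvPolynomial.eval ![x t, y t] (pderiv 1 Φ) * y') t := by
  induction Φ using MvPolynomial.induction_on with
  | C a =>
    simp only [MvPolynomial.eval_C, pderiv_C, map_zero, zero_mul, add_zero]
    exact hasDerivAt_const t a
  | add p q hp hq =>
    simp only [map_add]
    exact (hp.add hq).congr_deriv (by ring)
  | mul_X p i hp =>
    fin_cases i
    · have e1 : (fun s => MvPolynomial.eval ![x s, y s] (p * X 0)) =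
          fun s => MvPolynomial.eval ![x s, y s] p * x s := by
        funext s; simp [MvPolynomial.eval_X]
      simp only [Fin.zero_eta]
      rw [e1]
      refine (hp.mul hx).congr_deriv ?_
      simp only [Derivation.leibniz, smul_eq_mul, pderiv_X_self, pderiv_X_of_ne (show (0 : Fin 2) ≠ 1 by decide),
        map_add, map_mul, map_one, map_zero, MvPolynomial.eval_X, Matrix.cons_val_zero]
      ring
    · have e1 : (fun s => MvPolynomial.eval ![x s, y s] (p * X 1)) =
          fun s => MvPolynomial.eval ![x s, y s] p * y s := by
        funext s; simp [MvPolynomial.eval_X]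
      simp only [Fin.mk_one]
      rw [e1]
      refine (hp.mul hy).congr_deriv ?_
      simp only [Derivation.leibniz, smul_eq_mul, pderiv_X_self, pderiv_X_of_ne (show (1 : Fin 2) ≠ 0 by decide),
        map_add, map_mul, map_one, map_zero, MvPolynomial.eval_X, Matrix.cons_val_one, Matrix.cons_val_zero]
      ring

/-- Mixed partial derivatives of a polynomial commute. [folklore] -/
theorem pderiv_pderiv_comm {σ : Type*} (i j : σ) (Φ : MvPolynomial σ ℝ) :
    pderiv i (pderiv j Φ) = pderiv j (pderiv i Φ) := by
  classical
  induction Φ using MvPolynomial.induction_on with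
  | C a => simp only [pderiv_C, map_zero]
  | add p q hp hq => simp only [map_add, hp, hq]
  | mul_X p k hp =>
    simp only [Derivation.leibniz, smul_eq_mul, map_add, hp, pderiv_X]
    simp only [Pi.single_apply]
    split_ifs <;> simp <;> ring

/-! ### Implicit differentiation along a branch -/

/-- A function vanishing on an open interval has derivative `0` there. [folklore] -/
theorem hasDerivAt_zero_of_eqOn {F : ℝ → ℝ} {α ω t : ℝ} (hF : ∀ s ∈ Ioo α ω, F s = 0) (ht : t ∈ Ioo α ω) :
    HasDerivAt F 0 t := by
  have hev : F =ᶠ[nhds t] fun _ => (0 : ℝ) :=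
    Filter.eventuallyEq_of_mem (Ioo_mem_nhds ht.1 ht.2) fun s hs => hF s hs
  exact (hasDerivAt_const t (0 : ℝ)).congr_of_eventuallyEq hev

/-- **First-order identity along a branch**: if `Φ(s, β s) = 0` on an open interval and `β` is differentiable
there, then `Φ₀(t, β t) + Φ₁(t, β t)·β'(t) = 0`. [folklore] -/
theorem branch_first_order (Φ : MvPolynomial (Fin 2) ℝ) {β β₁ : ℝ → ℝ} {α ω t : ℝ}
    (hβ : ∀ s ∈ Ioo α ω, HasDerivAt β (β₁ s) s) (hΦ : ∀ s ∈ Ioo α ω, MvPolynomial.eval ![s, β s] Φ = 0)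
    (ht : t ∈ Ioo α ω) :
    MvPolynomial.eval ![t, β t] (pderiv 0 Φ) + MvPolynomial.eval ![t, β t] (pderiv 1 Φ) * β₁ t = 0 := by
  have h1 := hasDerivAt_mvPolynomial_eval Φ (hasDerivAt_id t) (hβ t ht)
  have h0 := hasDerivAt_zero_of_eqOn hΦ ht
  have := h1.unique h0
  simpa using this

/-- **Second-order identity along a branch**: differentiating the first-order identity once more,
`Φ₀₀ + Φ₁₀ β' + (Φ₀₁ + Φ₁₁ β') β' + Φ₁ β'' = 0` at every point of the arc. [folklore] -/
theorem branch_second_order (Φ : MvPolynomial (Fin 2) ℝ) {β β₁ β₂ : ℝ → ℝ} {α ω t : ℝ}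
    (hβ : ∀ s ∈ Ioo α ω, HasDerivAt β (β₁ s) s) (hβ₁ : ∀ s ∈ Ioo α ω, HasDerivAt β₁ (β₂ s) s)
    (hΦ : ∀ s ∈ Ioo α ω, MvPolynomial.eval ![s, β s] Φ = 0) (ht : t ∈ Ioo α ω) :
    MvPolynomial.eval ![t, β t] (pderiv 0 (pderiv 0 Φ))
      + MvPolynomial.eval ![t, β t] (pderiv 1 (pderiv 0 Φ)) * β₁ t
      + (MvPolynomial.eval ![t, β t] (pderiv 0 (pderiv 1 Φ))
          + MvPolynomial.eval ![t, β t] (pderiv 1 (pderiv 1 Φ)) * β₁ t) * β₁ t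
      + MvPolynomial.eval ![t, β t] (pderiv 1 Φ) * β₂ t = 0 := by
  -- the first-order quantity vanishes identically on the arc
  have hzero : ∀ s ∈ Ioo α ω, MvPolynomial.eval ![s, β s] (pderiv 0 Φ)
      + MvPolynomial.eval ![s, β s] (pderiv 1 Φ) * β₁ s = 0 := fun s hs => branch_first_order Φ hβ hΦ hs
  have h0 := hasDerivAt_zero_of_eqOn hzero ht
  have hA := hasDerivAt_mvPolynomial_eval (pderiv 0 Φ) (hasDerivAt_id t) (hβ t ht)
  have hB := hasDerivAt_mvPolynomial_eval (pderiv 1 Φ) (hasDerivAt_id t) (hβ t ht)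
  have hC := hB.mul (hβ₁ t ht)
  have hsum := hA.add hC
  have := hsum.unique h0
  simp only [id, mul_one] at this
  linear_combination this

/-! ### The bordered log-Hessian on a branch -/

/-- **Key identity.**  On a branch `b = β(t)` of `{Φ = 0}` (first- and second-order identities `h1`, `h2` with
`b₁ = β'(t)`, `b₂ = β''(t)`), the line's bordered log-Hessian
`H(Φ) = Ψ_uu Ψ_w² − 2Ψ_uw Ψ_u Ψ_w + Ψ_ww Ψ_u²` (`Ψ(u,w) = Φ(e^u, e^w)`, written with the Euler operators
`X_i ∂_i` and UNFOLDED token for token) takes the value `−t·b·Φ₁³·(b b₁ + t b b₂ − t b₁²)`; equivalently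
`t·b³·Φ₁³·(tβ'/β)' = −H(Φ)`. [folklore] -/
theorem logHessian_eval_eq (Φ : MvPolynomial (Fin 2) ℝ) (t b b₁ b₂ : ℝ)
    (h1 : MvPolynomial.eval ![t, b] (pderiv 0 Φ) + MvPolynomial.eval ![t, b] (pderiv 1 Φ) * b₁ = 0)
    (h2 : MvPolynomial.eval ![t, b] (pderiv 0 (pderiv 0 Φ))
      + MvPolynomial.eval ![t, b] (pderiv 1 (pderiv 0 Φ)) * b₁
      + (MvPolynomial.eval ![t, b] (pderiv 0 (pderiv 1 Φ))
          + MvPolynomial.eval ![t, b] (pderiv 1 (pderiv 1 Φ)) * b₁) * b₁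
      + MvPolynomial.eval ![t, b] (pderiv 1 Φ) * b₂ = 0) :
    MvPolynomial.eval ![t, b]
        (X 0 * pderiv 0 (X 0 * pderiv 0 Φ) * (X 1 * pderiv 1 Φ) ^ 2
          - 2 * (X 0 * pderiv 0 (X 1 * pderiv 1 Φ)) * (X 0 * pderiv 0 Φ) * (X 1 * pderiv 1 Φ)
          + X 1 * pderiv 1 (X 1 * pderiv 1 Φ) * (X 0 * pderiv 0 Φ) ^ 2) =
      -(t * b * MvPolynomial.eval ![t, b] (pderiv 1 Φ) ^ 3 * (b * b₁ + t * b * b₂ - t * b₁ ^ 2)) := by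
  have hcomm : MvPolynomial.eval ![t, b] (pderiv 1 (pderiv 0 Φ)) =
      MvPolynomial.eval ![t, b] (pderiv 0 (pderiv 1 Φ)) := by rw [pderiv_pderiv_comm]
  rw [hcomm] at h2
  simp only [map_sub, map_add, map_mul, map_pow, map_ofNat, Derivation.leibniz, smul_eq_mul, pderiv_X_self,
    pderiv_X_of_ne (show (1 : Fin 2) ≠ 0 by decide), mul_zero, add_zero, mul_one,
    MvPolynomial.eval_X, Matrix.cons_val_zero, Matrix.cons_val_one]
  set P0 := MvPolynomial.eval ![t, b] (pderiv 0 Φ) with hP0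
  set P1 := MvPolynomial.eval ![t, b] (pderiv 1 Φ) with hP1
  set P00 := MvPolynomial.eval ![t, b] (pderiv 0 (pderiv 0 Φ)) with hP00
  set P01 := MvPolynomial.eval ![t, b] (pderiv 0 (pderiv 1 Φ)) with hP01
  set P11 := MvPolynomial.eval ![t, b] (pderiv 1 (pderiv 1 Φ)) with hP11
  have hP0' : P0 = -(P1 * b₁) := by linarith
  have hP00' : P00 = -(P01 * b₁ + (P01 + P11 * b₁) * b₁ + P1 * b₂) := by linarith
  rw [hP0', hP00']
  ring

end OsculationPeel

end Summit.ValiantsHypothesis.ValiantsHypothesis.Theorems.LacunarySymmetroidMatrixDescartes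

end
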